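import Literature.Dynamics.Contraction.BirkhoffContractionCrossRatio
import HarnessLib

/-!
# Hopf's oscillation inequality for positive matrices and the spectral ratio bound `|λ| ≤ tanh(Δ∕4)·ρ(K)`
# (E. Hopf 1963 Thm 4; Ostrowski 1963/64; Bapat–Raghavan 1997 Thm 6.3.12; Eveson–Nussbaum 1995 Thm 3.5 (`N(L)`);
# Han–Han 2019 Thm 1.1)

Topic `Literature/Dynamics/Contraction`; companion of `BirkhoffContractionCrossRatio.lean` (Birkhoff's ratio form) and
`HilbertProjectiveMetric.lean` (the metric packaging).  THEOREMS ONLY (no definition, no named fact).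

THE RESULTS.  Let `K` be an entrywise positive `m × n` matrix whose `2 × 2` cross-ratios are bounded,
`K i j · K i' j' ≤ e^Δ · K i j' · K i' j` (projective diameter `Δ(K) ≤ Δ`, [EvesonNussbaum1995, Thm 6.2 (9) p. 52]).
* HOPF's OSCILLATION INEQUALITY.  For a positive vector `x` and ANY real vector `y` with `lo·x ≤ y ≤ hi·x`, the
  oscillation of `Ky` over `Kx` is at most Birkhoff's coefficient times `hi − lo`:
  `(Ky)_i∕(Kx)_i − (Ky)_{i'}∕(Kx)_{i'} ≤ tanh(Δ∕4)·(hi − lo)` for all `i, i'` (`mulVec_osc_le`, cleared of denominators),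
  i.e. Hopf's oscillation ratio `N(K) ≤ tanh(Δ∕4)` — [EvesonNussbaum1995, Def 3.3 p. 38 and Thm 3.5 p. 39:
  `N(L) = k(L) = tanh(Δ(L)∕4)`; BapatRaghavan1997, Thm 6.3.12: `Osc(A) ≤ tanh(Δ(A)∕4)`; Hopf1963 (Thm 4, cited through
  HanHan2019 p. 3)].  The proof is Bapat–Raghavan's (decompose `y = lo·x + p₁`, `(hi − lo)x = p₁ + p₂` with `p₁, p₂ ≥ 0`,
  bound the cross-ratio of `(Kp₁, Kp₂)` by the diameter, then AM–GM), with the AM–GM step organised as the algebraic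
  lemma `hopf_core_le`.
* THE SPECTRAL RATIO BOUND (Hopf's strengthening of Perron's theorem).  If `K` is square, `Kv = λ₀v` with `v > 0`
  (the Perron pair) and `Kw = λw` with `w` not a multiple of `v`, then `|λ| ≤ tanh(Δ∕4)·λ₀` — for REAL eigenpairs
  `abs_eigenvalue_le_tanh_mul`, and for COMPLEX eigenpairs `norm_eigenvalue_le_tanh_mul` (so the spectral ratio
  `κ(K) = max{|λ| : λ ∈ σ(K), λ ≠ ρ(K)}∕ρ(K)` satisfies `κ(K) ≤ τ(K) = (1 − √φ(K))∕(1 + √φ(K)) = tanh(Δ(K)∕4)`,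
  `φ(K) = min cross-ratio = e^{−Δ(K)}`) [HanHan2019, Thm 1.1 p. 3 (= arXiv:1906.04875), attributing it to Hopf1963 Thm 4 and
  Ostrowski 1964; EvesonNussbaum1995 p. 32 ("explicitly computable formulae for the spectral clearance")].  Proof: the
  oscillation over `v`, `O(y) = max_j y_j∕v_j − min_j y_j∕v_j`, is a seminorm vanishing exactly on `ℝv` with
  `O(Ky) ≤ tanh(Δ∕4)·λ₀·O(y)` (`ciSup_sub_ciInf_mulVec_le`); for a real eigenvector this gives the claim at once, and for a
  complex one we apply it to `y_φ = Re(e^{iφ}w)` and take the supremum over the phase `φ`, which is `|λ|`-covariant.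

HONEST FRAMING.  Finite-dimensional, entrywise-positive matrices only (Hopf's integral operators: TODO(general form), cf.
the Summits helper `…N19BirkhoffContractionIntegral`); no claim about the Perron root's existence is made here (it is a
hypothesis `Kv = λ₀v`, `v > 0`; Mathlib's Perron–Frobenius is not assumed).  Textbook material; nothing here concerns any
summit.  No `def`, no `instance`, no `sorry`; standard axioms.

## References
* [Hopf1963] E. Hopf, *An inequality for positive linear integral operators*, J. Math. Mech. 12 (1963) 683–692, Thm 4.
* [HanHan2019] W. Han, G. Han, *A new proof of Hopf's inequality using a complex extension of the Hilbert metric*,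
  arXiv:1906.04875, §1 Thm 1.1 (p. 3) and the displays (Hopf-Strengthening), `τ(A)`, `φ(A)`.
* [BapatRaghavan1997] R. B. Bapat, T. E. S. Raghavan, *Nonnegative matrices and applications*, CUP 1997, §6.3, Lemma 6.3.10,
  Thm 6.3.11, Thm 6.3.12 and the remark after it.
* [EvesonNussbaum1995] S. P. Eveson, R. D. Nussbaum, Math. Proc. Camb. Phil. Soc. 117 (1995) 31–55, Def 2.3 (oscillation,
  p. 33), Def 3.3 (p. 38), Thm 3.5 (p. 39), p. 32.
-/

noncomputable section

open Finset Real Matrix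

namespace Literature.Dynamics.Contraction

namespace BirkhoffHopf

/-! ## §1 The algebra of the AM–GM step -/

/-- **The AM–GM step of Hopf's inequality.**  For `q ≥ 1` and non-negative `A, B, C, D` with the cross-ratio bound
`A·D ≤ q²·B·C`: `(AD − CB)(q + 1) ≤ (q − 1)(A + B)(C + D)`.  (With `√(AC)·√(BD) = √(AD)·√(BC)`:
`(q−1)(AC + BD) − 2AD + 2qBC ≥ 2(q−1)√(AD)√(BC) − 2AD + 2qBC = 2(q√(BC) − √(AD))(√(BC) + √(AD)) ≥ 0`.)
[cite: BapatRaghavan1997, Thm 6.3.12 (proof: `t = √(vu) ≤ (v+u)∕2`, `(t²−1)∕(1+t²+2t) = (t−1)∕(t+1)`)] -/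
theorem hopf_core_le {q A B C D : ℝ} (hq : 1 ≤ q) (hA : 0 ≤ A) (hB : 0 ≤ B) (hC : 0 ≤ C) (hD : 0 ≤ D)
    (h : A * D ≤ q ^ 2 * (B * C)) : (A * D - C * B) * (q + 1) ≤ (q - 1) * ((A + B) * (C + D)) := by
  set sa := Real.sqrt (A * D) with hsa_def
  set sb := Real.sqrt (B * C) with hsb_def
  set tc := Real.sqrt (A * C) with htc_def
  set td := Real.sqrt (B * D) with htd_def
  have hsa : sa ^ 2 = A * D := Real.sq_sqrt (mul_nonneg hA hD)
  have hsb : sb ^ 2 = B * C := Real.sq_sqrt (mul_nonneg hB hC)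
  have htc : tc ^ 2 = A * C := Real.sq_sqrt (mul_nonneg hA hC)
  have htd : td ^ 2 = B * D := Real.sq_sqrt (mul_nonneg hB hD)
  have hsa0 : 0 ≤ sa := Real.sqrt_nonneg _
  have hsb0 : 0 ≤ sb := Real.sqrt_nonneg _
  have htc0 : 0 ≤ tc := Real.sqrt_nonneg _
  have htd0 : 0 ≤ td := Real.sqrt_nonneg _
  have hprod : tc * td = sa * sb := by
    rw [htc_def, htd_def, hsa_def, hsb_def, ← Real.sqrt_mul (mul_nonneg hA hC), ← Real.sqrt_mul (mul_nonneg hA hD)]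
    congr 1
    ring
  have hle : sa ≤ q * sb := by
    have hq0 : 0 ≤ q := by linarith
    calc sa = Real.sqrt (A * D) := rfl
      _ ≤ Real.sqrt (q ^ 2 * (B * C)) := Real.sqrt_le_sqrt h
      _ = q * sb := by rw [Real.sqrt_mul' _ (mul_nonneg hB hC), Real.sqrt_sq hq0]
  have hE : (q - 1) * ((A + B) * (C + D)) - (A * D - C * B) * (q + 1) =
      (q - 1) * (tc ^ 2 + td ^ 2) - 2 * sa ^ 2 + 2 * q * sb ^ 2 := by
    rw [htc, htd, hsa, hsb]; ring
  have h1 : 0 ≤ (q - 1) * (tc - td) ^ 2 := mul_nonneg (by linarith) (sq_nonneg _)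
  have h2 : 0 ≤ (q * sb - sa) * (sb + sa) := mul_nonneg (by linarith) (by linarith)
  have hprod' : q * (tc * td) = q * (sa * sb) := by rw [hprod]
  nlinarith [hE, h1, h2, hprod, hprod']

/-- `tanh(Δ∕4)·(q + 1) = q − 1` for `q = e^{Δ∕2}`. [cite: BapatRaghavan1997, Thm 6.3.12 (last step of the proof)] -/
theorem tanh_quarter_mul_add_one (Δ : ℝ) : Real.tanh (Δ / 4) * (exp (Δ / 2) + 1) = exp (Δ / 2) - 1 := by
  rw [tanh_quarter_eq]
  field_simp

/-! ## §2 Hopf's oscillation inequality -/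

section Osc

variable {m n : Type*} [Fintype n]

/-- `(K *ᵥ u) i = Σ_j K i j · u j`. [folklore] -/
private theorem mulVec_eq_sum (K : Matrix m n ℝ) (u : n → ℝ) (i : m) : (K *ᵥ u) i = ∑ j, K i j * u j := rfl

/-- **HOPF's OSCILLATION INEQUALITY** (two-index form, denominators cleared).  `K` entrywise positive with cross-ratios
`≤ e^Δ`, `x > 0`, `y` real with `lo·x ≤ y ≤ hi·x` componentwise.  Then for all rows `i, i'`:
`(Ky)_i (Kx)_{i'} − (Ky)_{i'} (Kx)_i ≤ tanh(Δ∕4)·(hi − lo)·(Kx)_i (Kx)_{i'}`, i.e.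
`osc(Ky∕Kx) ≤ tanh(Δ∕4)·osc(y∕x)`: Hopf's oscillation ratio is at most Birkhoff's coefficient.
[cite: BapatRaghavan1997, Thm 6.3.12; EvesonNussbaum1995, Thm 3.5 p. 39 (`N(L) = tanh(Δ(L)∕4)`); Hopf1963, Thm 4] -/
theorem mulVec_osc_le [Nonempty n] {K : Matrix m n ℝ} (hK : ∀ i j, 0 < K i j) {Δ : ℝ}
    (hΔ : ∀ i i' j j', K i j * K i' j' ≤ exp Δ * (K i j' * K i' j)) {x y : n → ℝ} (hx : ∀ j, 0 < x j)
    {lo hi : ℝ} (hlo : ∀ j, lo * x j ≤ y j) (hhi : ∀ j, y j ≤ hi * x j) (i i' : m) :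
    (K *ᵥ y) i * (K *ᵥ x) i' - (K *ᵥ y) i' * (K *ᵥ x) i ≤
      Real.tanh (Δ / 4) * (hi - lo) * ((K *ᵥ x) i * (K *ᵥ x) i') := by
  -- the decomposition `y = lo·x + p₁`, `(hi − lo)·x = p₁ + p₂`
  set p₁ : n → ℝ := fun j => y j - lo * x j with hp₁
  set p₂ : n → ℝ := fun j => hi * x j - y j with hp₂
  have hp₁0 : ∀ j, 0 ≤ p₁ j := fun j => sub_nonneg.2 (hlo j)
  have hp₂0 : ∀ j, 0 ≤ p₂ j := fun j => sub_nonneg.2 (hhi j)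
  set X : m → ℝ := K *ᵥ x with hX
  set a : m → ℝ := K *ᵥ p₁ with ha
  set b : m → ℝ := K *ᵥ p₂ with hb
  have haX : ∀ r, (K *ᵥ y) r = a r + lo * X r := by
    intro r
    simp only [ha, hX, mulVec_eq_sum, hp₁, Finset.mul_sum, ← Finset.sum_add_distrib]
    exact Finset.sum_congr rfl fun j _ => by ring
  have habX : ∀ r, a r + b r = (hi - lo) * X r := by
    intro r
    simp only [ha, hb, hX, mulVec_eq_sum, hp₁, hp₂, Finset.mul_sum, ← Finset.sum_add_distrib]
    exact Finset.sum_congr rfl fun j _ => by ring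
  have ha0 : ∀ r, 0 ≤ a r := fun r => by
    rw [ha, mulVec_eq_sum]; exact sum_nonneg fun j _ => mul_nonneg (hK r j).le (hp₁0 j)
  have hb0 : ∀ r, 0 ≤ b r := fun r => by
    rw [hb, mulVec_eq_sum]; exact sum_nonneg fun j _ => mul_nonneg (hK r j).le (hp₂0 j)
  have hX0 : ∀ r, 0 < X r := fun r => by
    rw [hX, mulVec_eq_sum]; exact sum_pos (fun j _ => mul_pos (hK r j) (hx j)) univ_nonempty
  -- the cross-ratio of `(a, b) = (Kp₁, Kp₂)` is bounded by the diameter (WEAK BOUND II)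
  have hcross : a i * b i' ≤ exp Δ * (b i * a i') := by
    have h := two_rows_le_exp_diam (s := univ) (a := fun j => K i j) (b := fun j => K i' j) (x := p₂) (y := p₁)
      (Δ := Δ) (fun j _ => hp₂0 j) (fun j _ => hp₁0 j) (fun k _ l _ => hΔ i i' k l)
    simpa [ha, hb, mulVec_eq_sum, mul_comm] using h
  -- `q = e^{Δ∕2} ≥ 1`
  set q : ℝ := exp (Δ / 2) with hq
  have j₀ := Classical.arbitrary n
  have hΔ0 : 0 ≤ Δ := by
    have h1 := hΔ i i j₀ j₀
    have hpos : 0 < K i j₀ * K i j₀ := mul_pos (hK i j₀) (hK i j₀)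
    exact one_le_exp_iff.1 (le_of_mul_le_mul_right (by simpa using h1) hpos)
  have hq1 : 1 ≤ q := one_le_exp (by linarith)
  have hq2 : q ^ 2 = exp Δ := by rw [hq, sq, ← exp_add]; ring_nf
  have hcore := hopf_core_le hq1 (ha0 i) (hb0 i) (ha0 i') (hb0 i') (by rw [hq2]; exact hcross)
  -- `(A D − C B) = (hi − lo)·LHS`, `(A+B)(C+D) = (hi−lo)²·X_i X_{i'}`
  have hLHS : (K *ᵥ y) i * X i' - (K *ᵥ y) i' * X i = a i * X i' - a i' * X i := by
    rw [haX i, haX i']; ring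
  have hδ0 : 0 ≤ hi - lo := by
    have := (hlo j₀).trans (hhi j₀)
    nlinarith [hx j₀]
  have hτ : Real.tanh (Δ / 4) * (q + 1) = q - 1 := tanh_quarter_mul_add_one Δ
  rcases eq_or_lt_of_le hδ0 with hδ | hδ
  · -- `hi = lo`: then `p₁ + p₂ = 0`, so `p₁ = 0`, `a = 0`, both sides vanish
    have hp : ∀ j, p₁ j = 0 := fun j => by
      have hsum : p₁ j + p₂ j = 0 := by simp only [hp₁, hp₂]; nlinarith [hx j]
      exact le_antisymm (by linarith [hp₂0 j]) (hp₁0 j)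
    have ha' : ∀ r, a r = 0 := fun r => by
      rw [ha, mulVec_eq_sum]; exact sum_eq_zero fun j _ => by rw [hp j, mul_zero]
    rw [hLHS, ha' i, ha' i', ← hδ]
    simp
  · -- `hi > lo`: divide `hcore` by `(hi − lo)(q + 1) > 0`
    have hq0 : 0 < q + 1 := by linarith
    have key : (hi - lo) * ((a i * X i' - a i' * X i) * (q + 1)) ≤
        (hi - lo) * (Real.tanh (Δ / 4) * (hi - lo) * (X i * X i') * (q + 1)) := by
      have e1 : (hi - lo) * ((a i * X i' - a i' * X i) * (q + 1)) = (a i * b i' - a i' * b i) * (q + 1) := by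
        have h1 : b i = (hi - lo) * X i - a i := by linarith [habX i]
        have h2 : b i' = (hi - lo) * X i' - a i' := by linarith [habX i']
        rw [h1, h2]; ring
      have e2 : (hi - lo) * (Real.tanh (Δ / 4) * (hi - lo) * (X i * X i') * (q + 1)) =
          (q - 1) * ((a i + b i) * (a i' + b i')) := by
        rw [habX i, habX i', ← hτ]; ring
      rw [e1, e2]
      exact hcore
    have key' := le_of_mul_le_mul_left key hδ
    rw [hLHS]
    exact le_of_mul_le_mul_right key' hq0

/-- The oscillation over a positive vector `v`, `O_v(y) = max_j y_j∕v_j − min_j y_j∕v_j`, is non-negative.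
[cite: EvesonNussbaum1995, Def 2.3 p. 33 (`ω(y∕x) ≥ 0`)] -/
theorem ciInf_div_le_ciSup_div [Nonempty n] (y v : n → ℝ) : (⨅ j, y j / v j) ≤ ⨆ j, y j / v j :=
  let j := Classical.arbitrary n
  (Finite.ciInf_le (fun j => y j / v j) j).trans (Finite.le_ciSup (fun j => y j / v j) j)

/-- `(min_j y_j∕v_j)·v_k ≤ y_k ≤ (max_j y_j∕v_j)·v_k` for `v > 0`. [cite: EvesonNussbaum1995, Def 2.3 p. 33 (`m(y∕x)x ≤ y ≤ M(y∕x)x`)] -/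
theorem ciInf_div_mul_le_and_le_ciSup_div_mul {y v : n → ℝ} (hv : ∀ j, 0 < v j) (k : n) :
    (⨅ j, y j / v j) * v k ≤ y k ∧ y k ≤ (⨆ j, y j / v j) * v k :=
  ⟨(le_div_iff₀ (hv k)).1 (Finite.ciInf_le (fun j => y j / v j) k),
    (div_le_iff₀ (hv k)).1 (Finite.le_ciSup (fun j => y j / v j) k)⟩

/-- **THE OSCILLATION OVER THE PERRON VECTOR CONTRACTS**: if `Kv = λ₀v` with `v > 0` then for every real `y`,
`O_v(Ky) ≤ tanh(Δ∕4)·λ₀·O_v(y)` where `O_v(y) = max_j y_j∕v_j − min_j y_j∕v_j` (a seminorm vanishing exactly on `ℝv`).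
[cite: HanHan2019, Thm 1.1 (proof strategy via Hopf's oscillation, p. 3); BapatRaghavan1997, Thm 6.3.12; Hopf1963, Thm 4] -/
theorem ciSup_sub_ciInf_mulVec_le [Nonempty n] {K : Matrix n n ℝ} (hK : ∀ i j, 0 < K i j) {Δ : ℝ}
    (hΔ : ∀ i i' j j', K i j * K i' j' ≤ exp Δ * (K i j' * K i' j)) {v : n → ℝ} (hv : ∀ j, 0 < v j) {lam0 : ℝ}
    (hKv : K *ᵥ v = lam0 • v) (y : n → ℝ) :
    (⨆ j, (K *ᵥ y) j / v j) - (⨅ j, (K *ᵥ y) j / v j) ≤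
      Real.tanh (Δ / 4) * lam0 * ((⨆ j, y j / v j) - (⨅ j, y j / v j)) := by
  set lo := ⨅ j, y j / v j with hlo
  set hi := ⨆ j, y j / v j with hhi
  obtain ⟨k₁, hk₁⟩ := exists_eq_ciSup_of_finite (f := fun j => (K *ᵥ y) j / v j)
  obtain ⟨k₂, hk₂⟩ := exists_eq_ciInf_of_finite (f := fun j => (K *ᵥ y) j / v j)
  rw [← hk₁, ← hk₂]
  have hb := fun k => ciInf_div_mul_le_and_le_ciSup_div_mul (y := y) hv k
  have h := mulVec_osc_le hK hΔ hv (fun k => (hb k).1) (fun k => (hb k).2) k₁ k₂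
  have hKv' : ∀ j, (K *ᵥ v) j = lam0 * v j := fun j => by rw [hKv]; simp
  rw [hKv' k₁, hKv' k₂] at h
  have hlam0 : 0 < lam0 := by
    have j := Classical.arbitrary n
    have h1 : 0 < (K *ᵥ v) j := by
      rw [mulVec_eq_sum]; exact sum_pos (fun l _ => mul_pos (hK j l) (hv l)) univ_nonempty
    rw [hKv' j] at h1
    exact pos_of_mul_pos_left h1 (hv j).le  -- hmm
  have hv1 := hv k₁
  have hv2 := hv k₂
  -- divide `h` by `lam0 · v k₁ · v k₂ > 0`
  rw [div_sub_div _ _ hv1.ne' hv2.ne', div_le_iff₀ (mul_pos hv1 hv2)]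
  have hc : 0 < lam0 * (v k₁ * v k₂) := mul_pos hlam0 (mul_pos hv1 hv2)
  have key : lam0 * ((K *ᵥ y) k₁ * v k₂ - v k₁ * (K *ᵥ y) k₂) ≤
      lam0 * (Real.tanh (Δ / 4) * lam0 * (hi - lo) * (v k₁ * v k₂)) := by
    nlinarith [h]
  exact le_of_mul_le_mul_left key hlam0

/-! ## §3 The spectral ratio bound — real eigenpairs -/

/-- **HOPF's STRENGTHENING OF PERRON's THEOREM (real eigenpairs).**  `K` square, entrywise positive, cross-ratios `≤ e^Δ`;
`Kv = λ₀v` with `v > 0`; `Kw = λw` with `w ∉ ℝv`.  Then `|λ| ≤ tanh(Δ∕4)·λ₀`.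
[cite: HanHan2019, Thm 1.1 p. 3 (`κ(A) ≤ τ(A)`, `τ(A) = (1−√φ(A))∕(1+√φ(A))`); Hopf1963, Thm 4; EvesonNussbaum1995, p. 32] -/
theorem abs_eigenvalue_le_tanh_mul [Nonempty n] {K : Matrix n n ℝ} (hK : ∀ i j, 0 < K i j) {Δ : ℝ}
    (hΔ : ∀ i i' j j', K i j * K i' j' ≤ exp Δ * (K i j' * K i' j)) {v w : n → ℝ} (hv : ∀ j, 0 < v j)
    {lam0 lam : ℝ} (hKv : K *ᵥ v = lam0 • v) (hKw : K *ᵥ w = lam • w) (hw : ∀ c : ℝ, w ≠ c • v) :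
    |lam| ≤ Real.tanh (Δ / 4) * lam0 := by
  set lo := ⨅ j, w j / v j with hlo
  set hi := ⨆ j, w j / v j with hhi
  have hO := ciSup_sub_ciInf_mulVec_le hK hΔ hv hKv w
  have hKw' : ∀ j, (K *ᵥ w) j / v j = lam * (w j / v j) := fun j => by rw [hKw]; simp [mul_div_assoc]
  simp_rw [hKw'] at hO
  -- `O(λ w) = |λ|·O(w)` and `O(w) > 0`
  have hpos : lo < hi := by
    refine lt_of_le_of_ne (ciInf_div_le_ciSup_div w v) fun heq => ?_
    apply hw lo
    funext j
    have hb := ciInf_div_mul_le_and_le_ciSup_div_mul (y := w) hv j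
    rw [← hlo, ← hhi, ← heq] at hb
    simp only [Pi.smul_apply, smul_eq_mul]
    exact le_antisymm hb.2 hb.1
  rcases le_or_gt 0 lam with hl | hl
  · rw [abs_of_nonneg hl]
    have h1 : (⨆ j, lam * (w j / v j)) = lam * hi := by rw [hhi, Real.mul_iSup_of_nonneg hl]
    have h2 : (⨅ j, lam * (w j / v j)) = lam * lo := by rw [hlo, Real.mul_iInf_of_nonneg hl]
    rw [h1, h2] at hO
    have : lam * (hi - lo) ≤ Real.tanh (Δ / 4) * lam0 * (hi - lo) := by nlinarith [hO]
    exact le_of_mul_le_mul_right this (by linarith)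
  · rw [abs_of_neg hl]
    have h1 : (⨆ j, lam * (w j / v j)) = lam * lo := by rw [hlo, Real.mul_iInf_of_nonpos hl.le]
    have h2 : (⨅ j, lam * (w j / v j)) = lam * hi := by rw [hhi, Real.mul_iSup_of_nonpos hl.le]
    rw [h1, h2] at hO
    have : -lam * (hi - lo) ≤ Real.tanh (Δ / 4) * lam0 * (hi - lo) := by nlinarith [hO]
    exact le_of_mul_le_mul_right this (by linarith)

/-! ## §4 The spectral ratio bound — complex eigenpairs (Han–Han Thm 1.1 in full) -/

omit [Fintype n] in
/-- Homogeneity of the oscillation over `v`: `O_v(c • z) = c·O_v(z)` for `c ≥ 0`.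
[cite: EvesonNussbaum1995, Def 2.3 p. 33 (`ω(sy∕tx) = s ω(y∕x)∕t`)] -/
theorem ciSup_sub_ciInf_smul [Nonempty n] {v : n → ℝ} {c : ℝ} (hc : 0 ≤ c) (z : n → ℝ) :
    (⨆ j, (c • z) j / v j) - (⨅ j, (c • z) j / v j) = c * ((⨆ j, z j / v j) - (⨅ j, z j / v j)) := by
  have e : (fun j => (c • z) j / v j) = fun j => c * (z j / v j) := funext fun j => by simp [mul_div_assoc]
  rw [e, ← Real.mul_iSup_of_nonneg hc, ← Real.mul_iInf_of_nonneg hc, mul_sub]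

/-- The oscillation over `v > 0` vanishes only on the ray: `max_j z_j∕v_j ≤ min_j z_j∕v_j` forces `z = c • v`.
[cite: EvesonNussbaum1995, Remark 2.5 p. 33 (`ω(y∕x) = 0` for `y = λx`) and Def 2.6; BapatRaghavan1997, Thm 6.3.6 (ii)] -/
theorem eq_smul_of_ciSup_le_ciInf [Nonempty n] {v : n → ℝ} (hv : ∀ j, 0 < v j) {z : n → ℝ}
    (h : (⨆ j, z j / v j) ≤ ⨅ j, z j / v j) : z = (⨅ j, z j / v j) • v := by
  funext j
  have hb := ciInf_div_mul_le_and_le_ciSup_div_mul (y := z) hv j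
  simp only [Pi.smul_apply, smul_eq_mul]
  refine le_antisymm (hb.2.trans ?_) hb.1
  exact mul_le_mul_of_nonneg_right h (hv j).le

/-- The phase-rotated real parts `y_φ = Re(e^{iφ} w)` of a complex vector are bounded over `v`:
`O_v(y_φ) ≤ 2·max_j ‖w_j‖∕v_j`. [cite: HanHan2019, §1 (the complex extension of the Hilbert metric, set-up)] -/
theorem ciSup_sub_ciInf_re_le [Nonempty n] {v : n → ℝ} (hv : ∀ j, 0 < v j) (w : n → ℂ) (φ : ℝ) :
    (⨆ j, (Complex.exp (φ * Complex.I) * w j).re / v j) - (⨅ j, (Complex.exp (φ * Complex.I) * w j).re / v j) ≤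
      2 * ⨆ j, ‖w j‖ / v j := by
  set M := ⨆ j, ‖w j‖ / v j with hM
  have hnorm : ∀ j, |(Complex.exp (φ * Complex.I) * w j).re| ≤ ‖w j‖ := fun j => by
    refine (Complex.abs_re_le_norm _).trans ?_
    rw [norm_mul, Complex.norm_exp_ofReal_mul_I, one_mul]
  have hup : ∀ j, (Complex.exp (φ * Complex.I) * w j).re / v j ≤ M := fun j =>
    (div_le_div_of_nonneg_right (le_of_abs_le (hnorm j)) (hv j).le).trans (Finite.le_ciSup (fun j => ‖w j‖ / v j) j)
  have hdown : ∀ j, -M ≤ (Complex.exp (φ * Complex.I) * w j).re / v j := fun j => by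
    have h1 : -‖w j‖ / v j ≤ (Complex.exp (φ * Complex.I) * w j).re / v j :=
      div_le_div_of_nonneg_right (neg_le_of_abs_le (hnorm j)) (hv j).le
    have h2 : ‖w j‖ / v j ≤ M := Finite.le_ciSup (fun j => ‖w j‖ / v j) j
    rw [neg_div] at h1
    linarith
  have hsup := ciSup_le hup
  have hinf := le_ciInf hdown
  linarith

/-- **HOPF's STRENGTHENING OF PERRON's THEOREM (complex eigenpairs; Han–Han Thm 1.1).**  `K` square, entrywise positive,
cross-ratios `≤ e^Δ` (so `tanh(Δ∕4) ≥ τ(K) = (1 − √φ(K))∕(1 + √φ(K))`, `φ(K)` the least cross-ratio); `Kv = λ₀v` with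
`v > 0`; `Kw = μw` over `ℂ` with `w ∉ ℂv`.  Then `‖μ‖ ≤ tanh(Δ∕4)·λ₀`: every eigenvalue other than the Perron root has
modulus at most `tanh(Δ(K)∕4)·ρ(K)`.  Proof: the oscillation seminorm over `v` contracts by `tanh(Δ∕4)·λ₀` under `K`
(`ciSup_sub_ciInf_mulVec_le`); applied to `y_φ = Re(e^{iφ}w)`, whose image is `Ky_φ = ‖μ‖·y_{φ+arg μ}`, and taking the
supremum over the phase gives `‖μ‖·S ≤ tanh(Δ∕4)·λ₀·S` with `S = sup_φ O_v(y_φ) > 0`.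
[cite: HanHan2019, Thm 1.1 p. 3; Hopf1963, Thm 4; EvesonNussbaum1995, p. 32 (spectral clearance)] -/
theorem norm_eigenvalue_le_tanh_mul [Nonempty n] {K : Matrix n n ℝ} (hK : ∀ i j, 0 < K i j) {Δ : ℝ}
    (hΔ : ∀ i i' j j', K i j * K i' j' ≤ exp Δ * (K i j' * K i' j)) {v : n → ℝ} (hv : ∀ j, 0 < v j) {lam0 : ℝ}
    (hKv : K *ᵥ v = lam0 • v) {w : n → ℂ} {μ : ℂ}
    (hKw : (K.map ((↑) : ℝ → ℂ)) *ᵥ w = μ • w) (hw : ∀ c : ℂ, w ≠ c • fun j => (v j : ℂ)) :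
    ‖μ‖ ≤ Real.tanh (Δ / 4) * lam0 := by
  -- the phase-rotated real parts and their oscillation over `v`
  set y : ℝ → n → ℝ := fun φ j => (Complex.exp (φ * Complex.I) * w j).re with hy
  set O : (n → ℝ) → ℝ := fun z => (⨆ j, z j / v j) - (⨅ j, z j / v j) with hO
  set θ : ℝ := Complex.arg μ with hθ
  set τ : ℝ := Real.tanh (Δ / 4) with hτ
  have i₀ := Classical.arbitrary n
  have hτ0 : 0 ≤ τ :=
    tanh_quarter_nonneg (one_le_exp_iff.1 (le_of_mul_le_mul_right (by simpa using hΔ i₀ i₀ i₀ i₀)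
      (mul_pos (hK i₀ i₀) (hK i₀ i₀))))
  have hlam0 : 0 < lam0 := by
    have h1 : 0 < (K *ᵥ v) i₀ := by
      rw [mulVec_eq_sum]; exact sum_pos (fun l _ => mul_pos (hK i₀ l) (hv l)) univ_nonempty
    rw [hKv] at h1
    simpa using pos_of_mul_pos_left (by simpa using h1) (hv i₀).le
  -- (1) the eigen-relation transported to the real parts: `K y_φ = ‖μ‖ • y_{φ+θ}`
  have hKw' : ∀ j, ∑ k, (K j k : ℂ) * w k = μ * w j := fun j => by
    have := congr_fun hKw j
    simpa [Matrix.mulVec, dotProduct, Matrix.map_apply] using this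
  have hrot : ∀ φ, K *ᵥ y φ = ‖μ‖ • y (φ + θ) := by
    intro φ
    funext j
    rw [mulVec_eq_sum]
    simp only [hy, Pi.smul_apply, smul_eq_mul]
    have e1 : ∑ k, K j k * (Complex.exp (φ * Complex.I) * w k).re =
        (Complex.exp (φ * Complex.I) * ∑ k, (K j k : ℂ) * w k).re := by
      rw [Finset.mul_sum, Complex.re_sum]
      refine Finset.sum_congr rfl fun k _ => ?_
      rw [← Complex.re_ofReal_mul]
      ring_nf
    have e2 : Complex.exp (φ * Complex.I) * μ = (‖μ‖ : ℂ) * Complex.exp (((φ + θ : ℝ) : ℂ) * Complex.I) := by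
      conv_lhs => rw [← Complex.norm_mul_exp_arg_mul_I μ]
      rw [← hθ, Complex.ofReal_add, add_mul, Complex.exp_add]
      ring
    rw [e1, hKw' j, ← mul_assoc, e2, mul_assoc, Complex.re_ofReal_mul]
  -- (2) contraction of the oscillation, phase by phase: `‖μ‖·O(y_{φ+θ}) ≤ τ·λ₀·O(y_φ)`
  have hstep : ∀ φ, ‖μ‖ * O (y (φ + θ)) ≤ τ * lam0 * O (y φ) := by
    intro φ
    have h := ciSup_sub_ciInf_mulVec_le hK hΔ hv hKv (y φ)
    rw [hrot φ] at h
    have e := ciSup_sub_ciInf_smul (v := v) (norm_nonneg μ) (y (φ + θ))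
    simp only [hO]
    linarith [h, e]
  -- (3) the supremum over the phase
  set S : ℝ := ⨆ φ : ℝ, O (y φ) with hS
  have hObdd : ∀ φ, O (y φ) ≤ 2 * ⨆ j, ‖w j‖ / v j := fun φ => ciSup_sub_ciInf_re_le hv w φ
  have hO0 : ∀ φ, 0 ≤ O (y φ) := fun φ => sub_nonneg.2 (ciInf_div_le_ciSup_div (y φ) v)
  have hbdd : BddAbove (Set.range fun φ : ℝ => O (y φ)) := ⟨2 * ⨆ j, ‖w j‖ / v j, by
    rintro _ ⟨φ, rfl⟩; exact hObdd φ⟩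
  have hleS : ∀ φ, O (y φ) ≤ S := fun φ => le_ciSup hbdd φ
  have hS0 : 0 ≤ S := (hO0 0).trans (hleS 0)
  have hmain : ‖μ‖ * S ≤ τ * lam0 * S := by
    rw [hS, Real.mul_iSup_of_nonneg (norm_nonneg μ)]
    refine ciSup_le fun ψ => ?_
    have h := hstep (ψ - θ)
    rw [sub_add_cancel] at h
    exact h.trans (mul_le_mul_of_nonneg_left (hleS (ψ - θ)) (mul_nonneg hτ0 hlam0.le))
  -- (4) `S > 0`: otherwise every `y_φ` is a multiple of `v`, and then so is `w`
  have hSpos : 0 < S := by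
    by_contra hle
    push Not at hle
    have hOz : ∀ φ, O (y φ) = 0 := fun φ => le_antisymm ((hleS φ).trans hle) (hO0 φ)
    have hprop : ∀ φ, y φ = (⨅ j, y φ j / v j) • v := fun φ =>
      eq_smul_of_ciSup_le_ciInf hv (sub_nonpos.1 (le_of_eq (hOz φ)))
    obtain ⟨c₀, hre⟩ : ∃ c₀ : ℝ, ∀ j, (w j).re = c₀ * v j :=
      ⟨⨅ j, y 0 j / v j, fun j => by
        have := congr_fun (hprop 0) j
        simpa [hy] using this⟩
    obtain ⟨c₁, h1⟩ : ∃ c₁ : ℝ, ∀ j, Real.cos 1 * (w j).re - Real.sin 1 * (w j).im = c₁ * v j :=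
      ⟨⨅ j, y 1 j / v j, fun j => by
        have := congr_fun (hprop 1) j
        simpa [hy, Complex.mul_re, Complex.exp_ofReal_mul_I_re, Complex.exp_ofReal_mul_I_im] using this⟩
    have hsin : 0 < Real.sin 1 := Real.sin_pos_of_pos_of_lt_pi one_pos (by linarith [Real.pi_gt_three])
    set c' : ℝ := (Real.cos 1 * c₀ - c₁) / Real.sin 1 with hc'
    have him : ∀ j, (w j).im = c' * v j := fun j => by
      rw [hc', div_mul_eq_mul_div, eq_div_iff hsin.ne']
      have := h1 j
      rw [hre j] at this
      linarith
    apply hw (c₀ + c' * Complex.I)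
    funext j
    apply Complex.ext
    · simp [Complex.mul_re, hre j]
    · simp [Complex.mul_im, him j]
  exact le_of_mul_le_mul_right hmain hSpos

end Osc

end BirkhoffHopf

end Literature.Dynamics.Contraction

end
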